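import Summits.BirchSwinnertonDyer.BirchSwinnertonDyer.Theorems.KimAtThreeShallowEqDeepGoodCoreVertexRat
import Summits.BirchSwinnertonDyer.Rank1Residual.GaloisImage.KolyvaginInjectivityAllDepths
import Summits.BirchSwinnertonDyer.Rank1Residual.GaloisImage.TorsionReductionOfLe
import Summits.BirchSwinnertonDyer.Rank1Residual.GaloisImage.SakamotoN11InstanceResidual
import Summits.BirchSwinnertonDyer.Rank1Residual.X11b.LevelShiftMaps
import HarnessLib

/-!
# Route `KimAtThreeKolyvagin` (rung W2), crux `ShallowEqDeepAtTorsionFree` (stmt-BirchSwinnertonDyer-19077):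
# the DÉVISSAGE of the good core vertex and its assembly at every depth `≥ 2` on the tower's deep classes

Cell `bsd-addord`, seat `bsd-addord-w2-c4` (D-0074 row B7), gen 3; third file of the GOOD CORE VERTEX
port (siblings `KimAtThreeShallowEqDeepGoodCoreVertex`, `…Rat`).  TOOL theorems only (no definition,
no named fact, no `sorry`); nothing asserted about any particular curve; nothing booked; no mark moved.
§6: the classical (Kummer) condition is CARTESIAN along `E[d] ↪ E[N]` at every place, no hypothesis
(`𝓛 = ker (H¹(E[n]) → H¹(E))`; Mazur–Rubin Lemma 3.7.1).  §7 `kummer_atLevel_eq_bot_of_residual`: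
`H¹_{𝓚̄(d)}(ℚ, E[3]) = 0 ⟹ H¹_{𝓚(d)}(ℚ, E[3^{k+1}·3]) = 0` under surj(3) and three local hypotheses at
the primes of `d` (Mazur–Rubin Lemma 3.5.3 + §6 + n1011's transverse pull-back).  §8: the local
hypotheses discharged on a deep Frobenius class (n1011 `KolyvaginInjectivityAllDepths` pattern) and
**`exists_goodCoreVertex_rat_three_deep`** = files 1–3 assembled: above every level a level `d` with
`H¹_{𝓚̄(d)}(ℚ,E[3]) = 0 = H¹_{𝓚̄(d)^*}`, `H¹_{𝓚(d)}(ℚ, E[3^{k+1}·3]) = 0`, `Λ ∘ loc₃` injective on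
`H¹_{𝓕_can(d)}` (EndCore's `hinj` at depth index `k + 1`), `3^{#d} ∣ 3^{#n}·#H¹_{𝓚̄(n)^*}`.
Not here: `hord` ([S24] Thm. 4.4 (1) at `λ^*(d) = 0`); the depth index `0` (`E[3^0·3]`).
References: [MazurRubin2004] Lemma 3.5.3, 3.7.1, Prop. 3.6.1, Cor. 4.1.9; [Sakamoto2024] Def. 3.5,
Lemma 5.2, Cor. 5.5; [Rubin2011] Prop. 1.4.13, 1.9.5, Cor. 2.7.3; [Kim2022StructureSelmer] Prop. 3.12.
-/

set_option autoImplicit false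
-- the Theorems namespace of a single-conjunct summit repeats the summit name by design (D-0017)
set_option linter.dupNamespace false

noncomputable section

open scoped Classical NumberField ContRepresentation
open Function Field NumberField IsDedekindDomain
open Literature.NumberTheory.GaloisRepresentations Literature.NumberTheory.GaloisRepresentations.DiscreteGaloisModule
  Literature.NumberTheory.GaloisCohomology
open Summit.BirchSwinnertonDyer.Rank1Residual.GaloisImage
open Summit.BirchSwinnertonDyer.Rank1Residual.GaloisImage.CoreRankZero
open Summit.BirchSwinnertonDyer.Rank1Residual.X11b.Levels

universe u

namespace Summit.BirchSwinnertonDyer.BirchSwinnertonDyer.Theorems.KimAtThreeShallowEqDeepGoodCoreVertex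

/-! ## §6. The Kummer condition is cartesian along `E[d] ↪ E[N]` at every place (no hypothesis) -/


section KummerCartesianCurve

open WeierstrassCurve Literature.NumberTheory.EllipticCurves

variable {K : Type u} [Field K] (W : WeierstrassCurve K) {d N : ℤ} (hdN : d ∣ N)

/-- **The local Kummer condition is CARTESIAN along `incl : E[d] ↪ E[N]` at any field `E/K`, with no
hypothesis**: `incl_* x ∈ 𝓛_E(E[N]) ↔ x ∈ 𝓛_E(E[d])`, since `𝓛_E(E[n]) = ker (H¹(E, E[n]) → H¹(E, E(K̄_E)))`
(`kummerLocalConditionAt`), `E[d] ↪ E[N] → E(K̄_E)` is `E[d] → E(K̄_E)`, and `H¹` is functorial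
(X11b `Levels.map_map_eq_map_of_comp_eq`) (Sakamoto Def. 3.5 for the
classical structure; Mazur–Rubin Lemma 3.7.1). [cite: Sakamoto2024, Def. 3.5 (p. 923)] [cite: MazurRubin2004, Lemma 3.7.1] -/
theorem map_torsionInclusion_mem_kummerLocalConditionAt_iff (E : Type u) [Field E] [Algebra K E]
    (x : galoisCohomology (GaloisRep.restrictField E (W.torsionGaloisModule d)) 1) :
    galoisCohomology.map ((W.torsionInclusion hdN).restrictField E) 1 x ∈
        W.kummerLocalConditionAt N E ↔ x ∈ W.kummerLocalConditionAt d E := by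
  rw [WeierstrassCurve.mem_kummerLocalConditionAt_iff, WeierstrassCurve.mem_kummerLocalConditionAt_iff,
    map_map_eq_map_of_comp_eq ((W.torsionInclusion hdN).restrictField E)
      (W.torsionPointsMapIntertwining N E) (W.torsionPointsMapIntertwining d E)]
  intro P
  rw [ContIntertwiningMap.restrictField_apply, WeierstrassCurve.torsionPointsMapIntertwining_apply,
    WeierstrassCurve.torsionPointsMapIntertwining_apply, WeierstrassCurve.coe_torsionInclusion_apply]

variable [NumberField K]

/-- **The Kummer Selmer structure is cartesian along `E[d] ↪ E[N]` at every place**: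
`incl_* x ∈ 𝓚_N(v) ↔ x ∈ 𝓚_d(v)`. [cite: Sakamoto2024, Def. 3.5 (p. 923)] [cite: MazurRubin2004, Lemma 3.7.1] -/
theorem localMap_torsionInclusion_mem_kummerSelmerStructure_iff (v : Place K)
    (x : galoisCohomology ((W.torsionGaloisModule d).toLocal v) 1) :
    localMap (W.torsionInclusion hdN) v x ∈ W.kummerSelmerStructure N v ↔
      x ∈ W.kummerSelmerStructure d v :=
  map_torsionInclusion_mem_kummerLocalConditionAt_iff W hdN (Place.Completion v) x

end KummerCartesianCurve


/-! ## §7. The dévissage `H¹_{𝓚̄(d)}(ℚ, E[3]) = 0 ⟹ H¹_{𝓚(d)}(ℚ, E[3^{k+1}·3]) = 0` -/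

section Devissage

open WeierstrassCurve Literature.NumberTheory.EllipticCurves
open Summit.BirchSwinnertonDyer.Rank1Residual.GaloisImage.KSDevissage
open Summit.BirchSwinnertonDyer.Rank1Residual.GaloisImage.TorsionLevel

variable (W : WeierstrassCurve ℚ) [W.IsElliptic] (k : ℕ)
  (red : (W.torsionGaloisModule (((3 : ℕ) : ℤ) ^ (k + 1) * ((3 : ℕ) : ℤ))).toContRepresentation →ⁱL
    (W.torsionGaloisModule (((3 : ℕ) : ℤ) ^ k * ((3 : ℕ) : ℤ))).toContRepresentation)
  (hred : ∀ x : geomTorsion W (((3 : ℕ) : ℤ) ^ (k + 1) * ((3 : ℕ) : ℤ)),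
    ((red x : geomTorsion W (((3 : ℕ) : ℤ) ^ k * ((3 : ℕ) : ℤ))) : geomPoints W) =
      ((3 : ℕ) : ℤ) • (x : geomPoints W))

include hred in
/-- **Dévissage of the level-`d` Kummer Selmer group along `E[3] ↪ E[3^{k+1}·3]`**: if
`H¹_{𝓚̄(d)}(ℚ, E[3]) = 0` (classical structure on `E[3]`, cyclotomic transverse conditions at `d`) then
`H¹_{𝓚(d)}(ℚ, E[3^{k+1}·3]) = 0`.  A non-zero class `y` has a non-zero multiple `z` with `3z = 0`;
`incl′_*(red_* z) = 3z = 0` with `incl′_*` injective (no `Γ_ℚ`-fixed points under surj(3)), so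
`red_* z = 0` and `z = incl_* x` (n1011 `TorsionLevel.exists_map_torsionInclusion_eq_of_map_red_eq_zero`);
`x ∈ H¹_{𝓚̄(d)}`: off `d` by §6, at `q ∈ d` by n1011's transverse pull-back
`mem_cyclotomicTransverse_of_localMap_mem` (local hypotheses `hsup₁`, `hinf₂`, `hinjloc`, discharged on a
deep class in §8); so `x = 0`, `z = 0`.  `red` = any equivariant `x ↦ 3x`
(`exists_torsionReduction_pow_mul 3 k (k+1)`). [cite: MazurRubin2004, Lemma 3.5.3 and Lemma 3.7.1]
[cite: Sakamoto2024, Def. 3.5 (p. 923)] [cite: Rubin2011, Prop. 1.9.5 (1) (p. 14)] -/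
theorem kummer_atLevel_eq_bot_of_residual
    (h3 : W.HasSurjectiveModNGaloisRep ((3 : ℕ) : ℤ))
    (D₁ : KolyvaginDatum (W.torsionGaloisModule ((3 : ℕ) : ℤ)))
    (D₂ : KolyvaginDatum (W.torsionGaloisModule (((3 : ℕ) : ℤ) ^ (k + 1) * ((3 : ℕ) : ℤ))))
    (hT₁ : D₁.transverse = cyclotomicTransverse _) (hT₂ : D₂.transverse = cyclotomicTransverse _)
    {d : Finset (HeightOneSpectrum (𝓞 ℚ))}
    (hsup₁ : ∀ q ∈ d,
      unramifiedSubgroup (GaloisRep.toLocal q (W.torsionGaloisModule ((3 : ℕ) : ℤ))) 1 ⊔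
        cyclotomicTransverse (W.torsionGaloisModule ((3 : ℕ) : ℤ)) (Sum.inr q) = ⊤)
    (hinf₂ : ∀ q ∈ d,
      unramifiedSubgroup (GaloisRep.toLocal q
          (W.torsionGaloisModule (((3 : ℕ) : ℤ) ^ (k + 1) * ((3 : ℕ) : ℤ)))) 1 ⊓
        cyclotomicTransverse (W.torsionGaloisModule (((3 : ℕ) : ℤ) ^ (k + 1) * ((3 : ℕ) : ℤ)))
          (Sum.inr q) = ⊥)
    (hinjloc : ∀ q ∈ d,
      Function.Injective (localMap (W.torsionInclusion (three_dvd_pow_succ_mul k)) (Sum.inr q)))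
    (hbot : (D₁.atLevel (W.kummerSelmerStructure ((3 : ℕ) : ℤ)) d).selmerGroup = ⊥) :
    (D₂.atLevel (W.kummerSelmerStructure (((3 : ℕ) : ℤ) ^ (k + 1) * ((3 : ℕ) : ℤ))) d).selmerGroup
      = ⊥ := by
  classical
  haveI : Fact (Nat.Prime 3) := ⟨Nat.prime_three⟩
  set incl := W.torsionInclusion (three_dvd_pow_succ_mul k) with hincl
  rw [eq_bot_iff]
  intro y hy
  rw [AddSubgroup.mem_bot]
  by_contra hy0
  -- a non-zero class of the `3`-group `H¹_{𝓚(d)}` has a non-zero multiple killed by `3`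
  have hex : ∃ j : ℕ, 3 ^ j • y = 0 := ⟨_, Transport.pow_succ_nsmul_galoisCohomology W (k + 1) y⟩
  have hm0 : 3 ^ Nat.find hex • y = 0 := Nat.find_spec hex
  have hmpos : 0 < Nat.find hex := by
    rcases Nat.eq_zero_or_pos (Nat.find hex) with h | h
    · rw [h, pow_zero, one_smul] at hm0; exact absurd hm0 hy0
    · exact h
  set z := 3 ^ (Nat.find hex - 1) • y with hz
  have hz0 : z ≠ 0 := Nat.find_min hex (m := Nat.find hex - 1) (by omega)
  have h3z : 3 • z = 0 := by
    rw [hz, ← mul_smul, ← pow_succ', show Nat.find hex - 1 + 1 = Nat.find hex by omega]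
    exact hm0
  have hzmem : z ∈ (D₂.atLevel (W.kummerSelmerStructure (((3 : ℕ) : ℤ) ^ (k + 1) * ((3 : ℕ) : ℤ)))
      d).selmerGroup := AddSubgroup.nsmul_mem _ hy _
  -- `red_* z = 0` (`incl′_* red_* z = 3 z = 0`, `incl′_*` injective), hence `z = incl_* x`
  have hΓ : ∀ P : geomTorsion W (((3 : ℕ) : ℤ) ^ (k + 1) * ((3 : ℕ) : ℤ)),
      (∀ σ : absoluteGaloisGroup ℚ, σ • P = P) → P = 0 :=
    Transport.geomTorsion_eq_zero_of_fixed_of_surj W h3 (k + 1)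
  have hredz : galoisCohomology.map red 1 z = 0 := by
    refine (injective_iff_map_eq_zero _).1
      (Transport.map_torsionInclusion_injective W (Nat.le_succ k) hΓ) _ ?_
    rw [Transport.map_torsionInclusion_map_red W (Nat.le_succ k) red (hred_pow W k red hred) z,
      show k + 1 - k = 1 by omega, pow_one, h3z]
  obtain ⟨x, hx⟩ := exists_map_torsionInclusion_eq_of_map_red_eq_zero W k red hred z hredz
  -- `x ∈ H¹_{𝓚̄(d)}(ℚ, E[3]) = 0`, place by place
  have hxmem : x ∈ (D₁.atLevel (W.kummerSelmerStructure ((3 : ℕ) : ℤ)) d).selmerGroup := by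
    rw [SelmerStructure.mem_selmerGroup_iff] at hzmem ⊢
    intro v
    have hv := hzmem v
    rw [← hx, CoreRankZero.localization_map_one_eq] at hv
    change localMap incl v (galoisCohomology.localization _ v 1 x) ∈ _ at hv
    rcases v with w | q
    · rw [Level.atLevel_inl] at hv ⊢
      exact (localMap_torsionInclusion_mem_kummerSelmerStructure_iff W _ (Sum.inl w) _).1 hv
    · by_cases hq : q ∈ d
      · rw [Level.atLevel_inr_of_mem _ _ hq, hT₂] at hv
        rw [Level.atLevel_inr_of_mem _ _ hq, hT₁]
        exact mem_cyclotomicTransverse_of_localMap_mem incl q (hsup₁ q hq) (hinf₂ q hq)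
          (hinjloc q hq) hv
      · rw [Level.atLevel_inr_of_not_mem _ _ hq] at hv ⊢
        exact (localMap_torsionInclusion_mem_kummerSelmerStructure_iff W _ (Sum.inr q) _).1 hv
  rw [hbot, AddSubgroup.mem_bot] at hxmem
  apply hz0
  rw [← hx, hxmem, map_zero]

end Devissage

/-! ## §8. Over `ℚ` on the DEEP Frobenius class of depth `k + 2`: every local shape discharged; the
GOOD CORE VERTEX (Selmer half + `hinj`) at every depth `≥ 2` -/

section RatDeep

open WeierstrassCurve Literature.NumberTheory.EllipticCurves
open Summit.BirchSwinnertonDyer.Rank1Residual.GaloisImage.KSDevissage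
open Summit.BirchSwinnertonDyer.Rank1Residual.GaloisImage.TorsionLevel

variable (W : WeierstrassCurve ℚ) [W.IsElliptic]

/-- **The dévissage on a DEEP class, local shapes discharged** (pattern of n1011
`KolyvaginInjectivityAllDepths.apply_eq_zero_of_apply_eq_zero_succ`): `ρ̄_{E,3}` onto; `τ` fixing
`μ_{3^{k+2}}` with `E[3^{j+1}]/(τ − 1) ≃ ℤ/3^{j+1}` at `j + 1 = k + 2, k + 1, 1`; `D₂` ADMISSIBLE on
`E[3^{k+1}·3]` with primes in Sakamoto's class of `τ` on `E[3^{k+1}·3]` and cyclotomic transverse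
conditions; `D₁` on `E[3]` with cyclotomic transverse conditions.  Then `H¹_{𝓚̄(d)}(ℚ, E[3]) = 0` at a
level `d` of `D₂` gives `H¹_{𝓚(d)}(ℚ, E[3^{k+1}·3]) = 0`. [cite: MazurRubin2004, Lemma 3.5.3, Cor. 4.1.9]
[cite: Sakamoto2024, Def. 3.5, Lemma 5.2, Cor. 5.5] [cite: Rubin2011, Prop. 1.4.13, Prop. 1.9.5] -/
theorem kummer_atLevel_eq_bot_of_residual_rat_deep (k : ℕ) [Finite (geomTorsion W ((3 : ℕ) : ℤ))]
    (h3 : W.HasSurjectiveModNGaloisRep ((3 : ℕ) : ℤ))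
    {Sset : Set (HeightOneSpectrum (𝓞 ℚ))} {τ : absoluteGaloisGroup ℚ}
    (hτμ : τ ∈ rootsOfUnityFixer ℚ (3 ^ (k + 1 + 1)))
    (hτ₂ : Nonempty (cokerSubOne (W.torsionGaloisModule (((3 : ℕ) : ℤ) ^ (k + 1) * ((3 : ℕ) : ℤ))) τ ≃+
      ZMod (3 ^ (k + 1 + 1))))
    (hτ₃ : Nonempty (cokerSubOne (W.torsionGaloisModule (((3 : ℕ) : ℤ) ^ k * ((3 : ℕ) : ℤ))) τ ≃+
      ZMod (3 ^ (k + 1))))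
    (hτ₁ : Nonempty (cokerSubOne (W.torsionGaloisModule ((3 : ℕ) : ℤ)) τ ≃+ ZMod 3))
    (D₁ : KolyvaginDatum (W.torsionGaloisModule ((3 : ℕ) : ℤ)))
    (D₂ : KolyvaginDatum (W.torsionGaloisModule (((3 : ℕ) : ℤ) ^ (k + 1) * ((3 : ℕ) : ℤ))))
    (hP₂ : D₂.primes ⊆ frobeniusClassPrimes
      (W.torsionGaloisModule (((3 : ℕ) : ℤ) ^ (k + 1) * ((3 : ℕ) : ℤ))) Sset τ (3 ^ (k + 1 + 1)))
    (hT₁ : D₁.transverse = cyclotomicTransverse _) (hT₂ : D₂.transverse = cyclotomicTransverse _)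
    (hadm₂ : D₂.IsAdmissible)
    {d : Finset (HeightOneSpectrum (𝓞 ℚ))} (hd : D₂.IsLevel d)
    (hbot : (D₁.atLevel (W.kummerSelmerStructure ((3 : ℕ) : ℤ)) d).selmerGroup = ⊥) :
    (D₂.atLevel (W.kummerSelmerStructure (((3 : ℕ) : ℤ) ^ (k + 1) * ((3 : ℕ) : ℤ))) d).selmerGroup
      = ⊥ := by
  classical
  haveI : Fact (Nat.Prime 3) := ⟨Nat.prime_three⟩
  haveI : NeZero (3 ^ (k + 1 + 1)) := ⟨pow_ne_zero _ (by norm_num)⟩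
  haveI : NeZero (3 ^ (k + 1)) := ⟨pow_ne_zero _ (by norm_num)⟩
  haveI : Finite (geomTorsion W (((3 : ℕ) : ℤ) ^ (k + 1) * ((3 : ℕ) : ℤ))) :=
    finite_geomTorsion_pow_mul W 3 (k + 1)
  haveI : Finite (geomTorsion W (((3 : ℕ) : ℤ) ^ k * ((3 : ℕ) : ℤ))) := finite_geomTorsion_pow_mul W 3 k
  -- the reduction `red : E[3^{k+1}·3] → E[3^k·3]`, `x ↦ 3x`
  obtain ⟨red, hred'⟩ := exists_torsionReduction_pow_mul W 3 k (k + 1)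
  have hred : ∀ x : geomTorsion W (((3 : ℕ) : ℤ) ^ (k + 1) * ((3 : ℕ) : ℤ)),
      ((red x : geomTorsion W (((3 : ℕ) : ℤ) ^ k * ((3 : ℕ) : ℤ))) : geomPoints W) =
        ((3 : ℕ) : ℤ) • (x : geomPoints W) := fun x => by
    rw [hred', Nat.add_sub_cancel_left, pow_one]
  -- sub-classes, roots of unity, exponents
  have hdvd₂₃ : 3 ^ (k + 1) ∣ 3 ^ (k + 1 + 1) := pow_dvd_pow 3 (Nat.le_succ _)
  have hdvd₂₁ : 3 ∣ 3 ^ (k + 1 + 1) := dvd_pow_self 3 (Nat.succ_ne_zero _)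
  have hker₃ : ∀ u : absoluteGaloisGroup ℚ,
      (W.torsionGaloisModule (((3 : ℕ) : ℤ) ^ (k + 1) * ((3 : ℕ) : ℤ))) u = 1 →
        (W.torsionGaloisModule (((3 : ℕ) : ℤ) ^ k * ((3 : ℕ) : ℤ))) u = 1 := fun u hu =>
    S24Deep.torsionGaloisModule_eq_one_of_dvd W (Transport.pow_mul_dvd_pow_mul (Nat.le_succ k)) u hu
  have hker₁ : ∀ u : absoluteGaloisGroup ℚ,
      (W.torsionGaloisModule (((3 : ℕ) : ℤ) ^ (k + 1) * ((3 : ℕ) : ℤ))) u = 1 →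
        (W.torsionGaloisModule ((3 : ℕ) : ℤ)) u = 1 := fun u hu =>
    S24Deep.torsionGaloisModule_eq_one_of_dvd W (three_dvd_pow_succ_mul k) u hu
  have hmono₃ : ∀ q ∈ d, q ∈ frobeniusClassPrimes
      (W.torsionGaloisModule (((3 : ℕ) : ℤ) ^ k * ((3 : ℕ) : ℤ))) Sset τ (3 ^ (k + 1)) := fun q hq =>
    S24Deep.frobeniusClassPrimes_mono (W.torsionGaloisModule (((3 : ℕ) : ℤ) ^ k * ((3 : ℕ) : ℤ)))
      (W.torsionGaloisModule (((3 : ℕ) : ℤ) ^ (k + 1) * ((3 : ℕ) : ℤ))) hker₃ Sset τ hdvd₂₃ (hP₂ (hd hq))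
  have hmono₁ : ∀ q ∈ d, q ∈ frobeniusClassPrimes (W.torsionGaloisModule ((3 : ℕ) : ℤ)) Sset τ 3 :=
    fun q hq => S24Deep.frobeniusClassPrimes_mono (W.torsionGaloisModule ((3 : ℕ) : ℤ))
      (W.torsionGaloisModule (((3 : ℕ) : ℤ) ^ (k + 1) * ((3 : ℕ) : ℤ))) hker₁ Sset τ hdvd₂₁ (hP₂ (hd hq))
  have hτμ₁ : τ ∈ rootsOfUnityFixer ℚ 3 := rootsOfUnityFixer_le_of_dvd ℚ hdvd₂₁ hτμ
  have hM₂ : ∀ m : geomTorsion W (((3 : ℕ) : ℤ) ^ (k + 1) * ((3 : ℕ) : ℤ)), 3 ^ (k + 1 + 1) • m = 0 :=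
    pow_succ_nsmul_geomTorsion_eq_zero W 3 (k + 1)
  have hM₁ : ∀ m : geomTorsion W ((3 : ℕ) : ℤ), 3 • m = 0 := three_nsmul_geomTorsion_three W
  -- per-prime instances and local shapes
  have hprime : ∀ q : HeightOneSpectrum (𝓞 ℚ), Fact (Ideal.absNorm q.asIdeal).Prime :=
    fun q => ⟨FSComp.prime_absNorm_rat q⟩
  have hne : ∀ q : HeightOneSpectrum (𝓞 ℚ),
      NeZero ((Ideal.absNorm q.asIdeal : ℕ) : q.adicCompletion ℚ) := fun q => by
    haveI : CharZero (q.adicCompletion ℚ) :=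
      charZero_of_injective_algebraMap (algebraMap ℚ (q.adicCompletion ℚ)).injective
    exact ⟨Nat.cast_ne_zero.2 (FSComp.prime_absNorm_rat q).ne_zero⟩
  have hsup₁ : ∀ q ∈ d, unramifiedSubgroup (GaloisRep.toLocal q (W.torsionGaloisModule ((3 : ℕ) : ℤ))) 1 ⊔
      cyclotomicTransverse (W.torsionGaloisModule ((3 : ℕ) : ℤ)) (Sum.inr q) = ⊤ := fun q hq => by
    haveI := hprime q; haveI := hne q
    exact unramifiedSubgroup_sup_cyclotomicTransverse_eq_top_of_mem_frobeniusClassPrimes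
      (W.torsionGaloisModule ((3 : ℕ) : ℤ)) (hmono₁ q hq)
      (absNorm_sub_one_smul_eq_zero_of_mem_frobeniusClassPrimes (W.torsionGaloisModule ((3 : ℕ) : ℤ))
        (hmono₁ q hq) hτμ₁ hM₁)
      (modPCyclotomicCharacter_surjOn_absInertia_rat_holds q)
  have hM₂' : ∀ q ∈ D₂.primes, ∀ m : geomTorsion W (((3 : ℕ) : ℤ) ^ (k + 1) * ((3 : ℕ) : ℤ)),
      (Ideal.absNorm q.asIdeal - 1) • m = 0 := fun q hq =>
    absNorm_sub_one_smul_eq_zero_of_mem_frobeniusClassPrimes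
      (W.torsionGaloisModule (((3 : ℕ) : ℤ) ^ (k + 1) * ((3 : ℕ) : ℤ))) (hP₂ hq) hτμ hM₂
  have hU₂ : ∀ q ∈ D₂.primes,
      Nat.card (unramifiedSubgroup (GaloisRep.toLocal q
        (W.torsionGaloisModule (((3 : ℕ) : ℤ) ^ (k + 1) * ((3 : ℕ) : ℤ)))) 1) = 3 ^ (k + 1 + 1) :=
    fun q hq => natCard_unramifiedSubgroup_toLocal_of_mem_frobeniusClassPrimes
      (W.torsionGaloisModule (((3 : ℕ) : ℤ) ^ (k + 1) * ((3 : ℕ) : ℤ))) (hP₂ hq) hτ₂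
  have hTc₂ : ∀ q ∈ D₂.primes, Nat.card (D₂.transverse (Sum.inr q)) = 3 ^ (k + 1 + 1) := fun q hq => by
    haveI := hprime q; haveI := hne q
    rw [hT₂]
    exact natCard_cyclotomicTransverse_rat_of_mem_frobeniusClassPrimes'
      (W.torsionGaloisModule (((3 : ℕ) : ℤ) ^ (k + 1) * ((3 : ℕ) : ℤ))) (hP₂ hq) hτ₂ (hM₂' q hq)
  have hUT₂ : ∀ q ∈ D₂.primes, unramifiedSubgroup (GaloisRep.toLocal q
      (W.torsionGaloisModule (((3 : ℕ) : ℤ) ^ (k + 1) * ((3 : ℕ) : ℤ)))) 1 ⊔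
        D₂.transverse (Sum.inr q) = ⊤ := fun q hq => by
    haveI := hprime q; haveI := hne q
    rw [hT₂]
    exact unramifiedSubgroup_sup_cyclotomicTransverse_eq_top_of_mem_frobeniusClassPrimes
      (W.torsionGaloisModule (((3 : ℕ) : ℤ) ^ (k + 1) * ((3 : ℕ) : ℤ))) (hP₂ hq)
      (hM₂' q hq) (modPCyclotomicCharacter_surjOn_absInertia_rat_holds q)
  have hinf₂ : ∀ q ∈ d, unramifiedSubgroup (GaloisRep.toLocal q
      (W.torsionGaloisModule (((3 : ℕ) : ℤ) ^ (k + 1) * ((3 : ℕ) : ℤ)))) 1 ⊓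
        cyclotomicTransverse (W.torsionGaloisModule (((3 : ℕ) : ℤ) ^ (k + 1) * ((3 : ℕ) : ℤ)))
          (Sum.inr q) = ⊥ := fun q hq => by
    rw [← hT₂]
    exact CoreRankOne.unramified_inf_transverse_eq_bot hadm₂ hU₂ hTc₂ hUT₂ (hd hq)
  have hinjloc : ∀ q ∈ d, Function.Injective
      (localMap (W.torsionInclusion (three_dvd_pow_succ_mul k)) (Sum.inr q)) := fun q hq =>
    TorsionLevel.localMap_torsionInclusion_injective W k red hred q
      (natCard_invariants_toLocal_of_mem_frobeniusClassPrimes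
        (W.torsionGaloisModule (((3 : ℕ) : ℤ) ^ (k + 1) * ((3 : ℕ) : ℤ))) (hP₂ (hd hq)) hτ₂)
      (natCard_invariants_toLocal_of_mem_frobeniusClassPrimes
        (W.torsionGaloisModule (((3 : ℕ) : ℤ) ^ k * ((3 : ℕ) : ℤ))) (hmono₃ q hq) hτ₃)
      (natCard_invariants_toLocal_of_mem_frobeniusClassPrimes
        (W.torsionGaloisModule ((3 : ℕ) : ℤ)) (hmono₁ q hq) hτ₁)
  exact kummer_atLevel_eq_bot_of_residual W k red hred h3 D₁ D₂ hT₁ hT₂ hsup₁ hinf₂ hinjloc hbot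

/-- **THE GOOD CORE VERTEX at depth `k + 2`, Selmer half and `hinj`, over `ℚ` on the tower's deep
class** (assembly of the three files): `ρ̄_{E,3}` onto, `Sel^{(3)}(E/ℚ)` finite, `S ⊇ ∞ ∪ {3} ∪ {bad}`,
a Poitou–Tate family at `3`, `τ` as above, `D₁` on `E[3]` and `D₂` (admissible) on `E[3^{k+1}·3]` with
THE SAME primes `frobeniusClassPrimes (E[3^{k+1}·3]) {v ∈ S} τ 3^{k+2}` and cyclotomic transverse
conditions, the dictionary functional `Λ` at `v₃ ∣ 3` with the DICT3 kernel clause.  THEN above every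
level `n` there is a level `d ⊇ n` with (i) `H¹_{𝓚̄(d)}(ℚ, E[3]) = 0 = H¹_{𝓚̄(d)^*}`, (ii)
`H¹_{𝓚(d)}(ℚ, E[3^{k+1}·3]) = 0`, (iii) `Λ ∘ loc_{v₃}` injective on `H¹_{𝓕_can(d)}(ℚ, E[3^{k+1}·3])` —
VERBATIM the `hinj` of `KimAtThreeDeepUpperEndCore.EndCore.exists_certificate_of_witnessAt` at depth
index `k + 1` — and (iv) `3^{#d} ∣ 3^{#n} · #H¹_{𝓚̄(n)^*}(ℚ, E[3]^D)` (a bound independent of `k`).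
Not here: `hord`; the depth index `0`. [cite: MazurRubin2004, Prop. 3.6.1, Lemma 3.5.3, Cor. 4.1.9]
[cite: Sakamoto2024, Def. 3.5, Cor. 5.5] [cite: Rubin2011, Cor. 2.7.3] [cite: Kim2022StructureSelmer, Prop. 3.12] -/
theorem exists_goodCoreVertex_rat_three_deep (k : ℕ)
    [Finite (geomTorsion W ((3 : ℕ) : ℤ))]
    (h3 : W.HasSurjectiveModNGaloisRep ((3 : ℕ) : ℤ))
    (τ : absoluteGaloisGroup ℚ) (hτμ : τ ∈ rootsOfUnityFixer ℚ (3 ^ (k + 1 + 1)))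
    (hτ₂ : Nonempty (cokerSubOne (W.torsionGaloisModule (((3 : ℕ) : ℤ) ^ (k + 1) * ((3 : ℕ) : ℤ))) τ ≃+
      ZMod (3 ^ (k + 1 + 1))))
    (hτ₃ : Nonempty (cokerSubOne (W.torsionGaloisModule (((3 : ℕ) : ℤ) ^ k * ((3 : ℕ) : ℤ))) τ ≃+
      ZMod (3 ^ (k + 1))))
    (hτ₁ : Nonempty (cokerSubOne (W.torsionGaloisModule ((3 : ℕ) : ℤ)) τ ≃+ ZMod 3))
    (inv : LocalInvariants ℚ 3) (hperf : inv.IsPerfect) (hsum : inv.SumLocalTermEqZero)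
    (hcompl : inv.SelmerComplement)
    (S : Finset (Place ℚ)) (hS : ∀ w : InfinitePlace ℚ, (Sum.inl w : Place ℚ) ∈ S)
    (h3S : ∀ v : HeightOneSpectrum (𝓞 ℚ), ((3 : ℕ) : 𝓞 ℚ) ∈ v.asIdeal → (Sum.inr v : Place ℚ) ∈ S)
    (hbadS : ∀ v : HeightOneSpectrum (𝓞 ℚ), ¬ W.HasGoodReductionAt v → (Sum.inr v : Place ℚ) ∈ S)
    [hfin : Finite (W.kummerSelmerStructure ((3 : ℕ) : ℤ)).selmerGroup]
    (D₁ : KolyvaginDatum (W.torsionGaloisModule ((3 : ℕ) : ℤ)))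
    (D₂ : KolyvaginDatum (W.torsionGaloisModule (((3 : ℕ) : ℤ) ^ (k + 1) * ((3 : ℕ) : ℤ))))
    (hP₁ : D₁.primes = frobeniusClassPrimes (W.torsionGaloisModule (((3 : ℕ) : ℤ) ^ (k + 1) * ((3 : ℕ) : ℤ)))
      {v | (Sum.inr v : Place ℚ) ∈ S} τ (3 ^ (k + 1 + 1)))
    (hP₂ : D₂.primes = frobeniusClassPrimes (W.torsionGaloisModule (((3 : ℕ) : ℤ) ^ (k + 1) * ((3 : ℕ) : ℤ)))
      {v | (Sum.inr v : Place ℚ) ∈ S} τ (3 ^ (k + 1 + 1)))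
    (hT₁ : D₁.transverse = cyclotomicTransverse _) (hT₂ : D₂.transverse = cyclotomicTransverse _)
    (hadm₂ : D₂.IsAdmissible)
    (v₃ : HeightOneSpectrum (𝓞 ℚ)) (hv₃ : ((3 : ℕ) : 𝓞 ℚ) ∈ v₃.asIdeal)
    (Λ : galoisCohomology ((W.torsionGaloisModule (((3 : ℕ) : ℤ) ^ (k + 1) * ((3 : ℕ) : ℤ))).toLocal
      (Sum.inr v₃)) 1 →+ ZMod (3 ^ (k + 1 + 1)))
    (hker : ∀ x ∈ propagatedSelmerStructure W 3 (k + 1) (Sum.inr v₃),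
      Λ x = 0 ↔ x ∈ W.kummerSelmerStructure (((3 : ℕ) : ℤ) ^ (k + 1) * ((3 : ℕ) : ℤ)) (Sum.inr v₃))
    {n : Finset (HeightOneSpectrum (𝓞 ℚ))} (hn : D₂.IsLevel n) :
    ∃ d, n ⊆ d ∧ D₂.IsLevel d ∧
      (D₁.atLevel (W.kummerSelmerStructure ((3 : ℕ) : ℤ)) d).selmerGroup = ⊥ ∧
      (inv.dualSelmerStructure (W.torsionGaloisModule ((3 : ℕ) : ℤ))
        (D₁.atLevel (W.kummerSelmerStructure ((3 : ℕ) : ℤ)) d)).selmerGroup = ⊥ ∧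
      (D₂.atLevel (W.kummerSelmerStructure (((3 : ℕ) : ℤ) ^ (k + 1) * ((3 : ℕ) : ℤ))) d).selmerGroup = ⊥ ∧
      (∀ x ∈ (D₂.atLevel (propagatedSelmerStructure W 3 (k + 1)) d).selmerGroup,
        Λ (galoisCohomology.localization _ (Sum.inr v₃) 1 x) = 0 → x = 0) ∧
      3 ^ d.card ∣ 3 ^ n.card * Nat.card (inv.dualSelmerStructure (W.torsionGaloisModule ((3 : ℕ) : ℤ))
        (D₁.atLevel (W.kummerSelmerStructure ((3 : ℕ) : ℤ)) n)).selmerGroup := by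
  haveI : Fact (Nat.Prime 3) := ⟨Nat.prime_three⟩
  have hlev : ∀ e : Finset (HeightOneSpectrum (𝓞 ℚ)), D₂.IsLevel e ↔ D₁.IsLevel e := fun e => by
    simp only [KolyvaginDatum.IsLevel, hP₁, hP₂]
  obtain ⟨d, hnd, hd₁, hdual, hbot₁, hdiv⟩ := exists_superset_kummerSelmerGroup_eq_bot_rat_three_deep W h3
    (k + 1) τ hτμ hτ₁ inv hperf hsum hcompl S hS h3S hbadS D₁ hP₁ hT₁ ((hlev n).1 hn)
  have hd₂ : D₂.IsLevel d := (hlev d).2 hd₁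
  have hbot₂ := kummer_atLevel_eq_bot_of_residual_rat_deep W k h3 hτμ hτ₂ hτ₃ hτ₁ D₁ D₂ (subset_of_eq hP₂)
    hT₁ hT₂ hadm₂ hd₂ hbot₁
  have hv₃d : v₃ ∉ d := fun h => by
    have hmem : v₃ ∈ D₂.primes := hd₂ h
    rw [hP₂] at hmem
    exact hmem.1 (h3S v₃ hv₃)
  refine ⟨d, hnd, hd₂, hbot₁, hdual, hbot₂, ?_, hdiv⟩
  exact localization_injOn_atLevel_of_kummer_atLevel_eq_bot W 3 (k + 1) (by norm_num) hv₃ Λ hker D₂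
    hv₃d hbot₂

end RatDeep

end Summit.BirchSwinnertonDyer.BirchSwinnertonDyer.Theorems.KimAtThreeShallowEqDeepGoodCoreVertex

end
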